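import Summits.RiemannHypothesis.RiemannHypothesis.Theorems.WeilGroundStateGroundStatesConvergeToXiStubEnergyCauchy
import Literature.NumberTheory.LFunctions.WeilGroundStateRealZerosProofs
import Literature.NumberTheory.LFunctions.WeilZeroSum
import Mathlib.Topology.Algebra.InfiniteSum.Real
import Mathlib.Order.Filter.AtTopBot.Prod
import HarnessLib

/-!
# Stub `stub_samplingCauchy` of the line `Sketch` (crux `WeilGroundState.GroundStatesConvergeToXi`,
item stmt-RiemannHypothesis-1527, rev L9, wave 2 / W11a)

**`ℓ²(m)`-convergence of the zero samples along a minimising sequence (RH-free).**  Let `u` be a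
Weil ground state at the window `a`, `L²`-limit of the normalised minimising sequence `gₙ` of
test functions on `[-a, a]`, and assume the zero-sampling map `g ↦ (ĝ(ρ))_ρ` is FORM-BOUNDED on
window test functions: `Σ_ρ m(ρ)‖ĝ(ρ)‖² ≤ A·Re Q(g) + B·‖g‖₂²` (hypothesis; the neighbouring stub
`stub_formBoundedSampling`).  Then `Σ_ρ m(ρ)‖û(ρ)‖² < ∞`, every `Σ_ρ m(ρ)‖ĝₙ(ρ) − û(ρ)‖²` is
finite, and `Σ_ρ m(ρ)‖ĝₙ(ρ) − û(ρ)‖² → 0`.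

Proof.
1. The sequence is Cauchy in energy (`stub_energyCauchy`: `Re Q(gₙ − g_k) → 0` on `ℕ × ℕ`) and in
   `L²` (`‖gₙ − g_k‖₂ ≤ ‖gₙ − u‖₂ + ‖g_k − u‖₂`), so by form-boundedness applied to the window
   test function `gₙ − g_k` (`IsWeilTest.sub`, `weilMellin_sub`) the modulus
   `δ(n,k) = Σ_ρ m‖ĝₙ(ρ) − ĝ_k(ρ)‖² ≤ A·Re Q(gₙ − g_k) + B‖gₙ − g_k‖₂²` tends to `0`.
2. Termwise `ĝ_k(ρ) → û(ρ)` (`ConnesVanSuijlekom.tendsto_weilMellin`), so every FINITE partial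
   sum `Σ_{ρ ∈ T} m‖ĝₙ(ρ) − û(ρ)‖²` is the limit of `Σ_{ρ ∈ T} m‖ĝₙ(ρ) − ĝ_k(ρ)‖² ≤ δ(n,k) ≤ ε`
   for `n, k ≥ N(ε)` (Fatou on finite partial sums, `le_of_tendsto`).
3. Uniformly bounded partial sums of a non-negative family give summability and the `tsum`
   bound (`summable_of_sum_le`, `Real.tsum_le_of_sum_le`): `Σ_ρ m‖ĝₙ − û‖² ≤ ε` for `n ≥ N(ε)`.
   For the remaining `n` and for `û` itself use `‖x − z‖² ≤ 2‖x − y‖² + 2‖y − z‖²` through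
   `g_{max n N}` resp. `g_N` (`Summable.of_nonneg_of_le`).

Mathlib + proved tree material only; no named fact; no definitions; standard axioms.
-/

set_option linter.dupNamespace false

noncomputable section

open MeasureTheory Complex Filter Set
open scoped Real Topology ComplexConjugate

namespace Summit.RiemannHypothesis.RiemannHypothesis.Theorems.GroundStatesConvergeToXi

open Literature.NumberTheory.LFunctions

/-! ### Elementary inequalities -/

/-- Weighted parallelogram-type bound `m‖x − z‖² ≤ 2(m‖x − y‖²) + 2(m‖y − z‖²)` for `m ≥ 0`
(triangle inequality and `(a + b)² ≤ 2a² + 2b²`). [folklore] -/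
theorem samplingCauchy_mul_norm_sub_sq_le {m : ℝ} (hm : 0 ≤ m) (x y z : ℂ) :
    m * ‖x - z‖ ^ 2 ≤ 2 * (m * ‖x - y‖ ^ 2) + 2 * (m * ‖y - z‖ ^ 2) := by
  have h0 : ‖x - z‖ ^ 2 ≤ 2 * ‖x - y‖ ^ 2 + 2 * ‖y - z‖ ^ 2 := by
    have h := norm_sub_le_norm_sub_add_norm_sub x y z
    have h1 : ‖x - z‖ ^ 2 ≤ (‖x - y‖ + ‖y - z‖) ^ 2 := pow_le_pow_left₀ (norm_nonneg _) h 2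
    nlinarith [sq_nonneg (‖x - y‖ - ‖y - z‖)]
  have h := mul_le_mul_of_nonneg_left h0 hm
  have e : m * (2 * ‖x - y‖ ^ 2 + 2 * ‖y - z‖ ^ 2) =
      2 * (m * ‖x - y‖ ^ 2) + 2 * (m * ‖y - z‖ ^ 2) := by ring
  linarith

/-! ### `L²`-convergent sequences are `L²`-Cauchy -/

/-- If `gₙ → u` in `L²` then `∫‖gₙ − gₘ‖² → 0` along `atTop` on `ℕ × ℕ` (Minkowski:
`‖gₙ − gₘ‖₂ ≤ ‖gₙ − u‖₂ + ‖gₘ − u‖₂`). [folklore] -/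
theorem samplingCauchy_tendsto_integral_norm_sq_sub {u : ℝ → ℂ} {g : ℕ → ℝ → ℂ}
    (hu : MemLp u 2) (hgm : ∀ n, MemLp (g n) 2)
    (hL : Tendsto (fun n ↦ ∫ t, ‖g n t - u t‖ ^ 2) atTop (𝓝 0)) :
    Tendsto (fun p : ℕ × ℕ ↦ ∫ t, ‖g p.1 t - g p.2 t‖ ^ 2) atTop (𝓝 0) := by
  have hfst : Tendsto (Prod.fst : ℕ × ℕ → ℕ) atTop atTop := by
    rw [← prod_atTop_atTop_eq]
    exact tendsto_fst
  have hsnd : Tendsto (Prod.snd : ℕ × ℕ → ℕ) atTop atTop := by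
    rw [← prod_atTop_atTop_eq]
    exact tendsto_snd
  have hsq : ∀ p : ℕ × ℕ, Real.sqrt (∫ t, ‖g p.1 t - g p.2 t‖ ^ 2) ≤
      Real.sqrt (∫ t, ‖g p.1 t - u t‖ ^ 2) + Real.sqrt (∫ t, ‖g p.2 t - u t‖ ^ 2) := by
    intro p
    have h1 := sqrt_integral_norm_sq_sub_le (f := fun t ↦ g p.1 t - u t)
      (h := fun t ↦ g p.2 t - u t) ((hgm p.1).sub hu) ((hgm p.2).sub hu)
    simpa only [sub_sub_sub_cancel_right] using h1
  have hA1 : Tendsto (fun p : ℕ × ℕ ↦ ∫ t, ‖g p.1 t - u t‖ ^ 2) atTop (𝓝 0) := hL.comp hfst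
  have hA2 : Tendsto (fun p : ℕ × ℕ ↦ ∫ t, ‖g p.2 t - u t‖ ^ 2) atTop (𝓝 0) := hL.comp hsnd
  have h0 : Tendsto (fun p : ℕ × ℕ ↦ Real.sqrt (∫ t, ‖g p.1 t - u t‖ ^ 2) +
      Real.sqrt (∫ t, ‖g p.2 t - u t‖ ^ 2)) atTop (𝓝 0) := by
    simpa using hA1.sqrt.add hA2.sqrt
  have h1 : Tendsto (fun p : ℕ × ℕ ↦ Real.sqrt (∫ t, ‖g p.1 t - g p.2 t‖ ^ 2)) atTop (𝓝 0) :=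
    squeeze_zero (fun p ↦ Real.sqrt_nonneg _) hsq h0
  have h2 := h1.pow 2
  rw [zero_pow two_ne_zero] at h2
  exact h2.congr fun p ↦ Real.sq_sqrt (integral_nonneg fun _ ↦ by positivity)

/-! ### The stub -/

/-- **Stub W11a — `ℓ²(m)`-convergence of the zero samples along a minimising sequence
(RH-free).**  If the zero-sampling map is form-bounded on window test functions
(`Σ_ρ m(ρ)‖ĝ(ρ)‖² ≤ A·Re Q(g) + B‖g‖₂²`), then along the minimising sequence `gₙ → u` of a Weil
ground state `u` at the window `a`: `Σ_ρ m(ρ)‖û(ρ)‖² < ∞`, each `Σ_ρ m(ρ)‖ĝₙ(ρ) − û(ρ)‖²` is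
finite, and `Σ_ρ m(ρ)‖ĝₙ(ρ) − û(ρ)‖² → 0`.  (The sequence is Cauchy in energy and in `L²`, hence
the samples are Cauchy in `ℓ²(m)`; termwise `ĝₙ(ρ) → û(ρ)`; Fatou on finite partial sums.)
[folklore] -/
theorem stub_samplingCauchy :
    (∀ a : ℝ, 0 < a → ∃ A B : ℝ, 0 ≤ A ∧ 0 ≤ B ∧ ∀ g : ℝ → ℂ, IsWeilTest g →
      tsupport g ⊆ Icc (-a) a →
        Summable (fun ρ : ZetaZeros.riemannZetaNontrivialZeros =>
          (riemannZetaZeroOrder (ρ : ℂ) : ℝ) * ‖weilMellin g ρ‖ ^ 2) ∧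
        ∑' ρ : ZetaZeros.riemannZetaNontrivialZeros,
            (riemannZetaZeroOrder (ρ : ℂ) : ℝ) * ‖weilMellin g ρ‖ ^ 2 ≤
          A * (weilQuadratic g).re + B * ∫ t : ℝ, ‖g t‖ ^ 2) →
    ∀ (a : ℝ) (u : ℝ → ℂ) (g : ℕ → ℝ → ℂ), IsWeilGroundState a u →
      (∀ n, IsWeilTest (g n) ∧ tsupport (g n) ⊆ Icc (-a) a ∧ ∫ t, ‖g n t‖ ^ 2 = (1 : ℝ)) →
      Tendsto (fun n => (weilQuadratic (g n)).re) atTop (𝓝 (weilGroundEnergy a)) →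
      Tendsto (fun n => ∫ t, ‖g n t - u t‖ ^ 2) atTop (𝓝 0) →
        Summable (fun ρ : ZetaZeros.riemannZetaNontrivialZeros =>
          (riemannZetaZeroOrder (ρ : ℂ) : ℝ) * ‖weilMellin u ρ‖ ^ 2) ∧
        (∀ n, Summable (fun ρ : ZetaZeros.riemannZetaNontrivialZeros =>
          (riemannZetaZeroOrder (ρ : ℂ) : ℝ) * ‖weilMellin (g n) ρ - weilMellin u ρ‖ ^ 2)) ∧
        Tendsto (fun n => ∑' ρ : ZetaZeros.riemannZetaNontrivialZeros,
          (riemannZetaZeroOrder (ρ : ℂ) : ℝ) * ‖weilMellin (g n) ρ - weilMellin u ρ‖ ^ 2)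
          atTop (𝓝 0) := by
  intro HF a u g hu hg hQ hL
  obtain ⟨A, B, -, -, hAB⟩ := HF a hu.pos
  have hgm : ∀ n, MemLp (g n) 2 := fun n ↦
    (hg n).1.1.continuous.memLp_of_hasCompactSupport (hg n).1.2
  have hm0 : ∀ ρ : ZetaZeros.riemannZetaNontrivialZeros,
      (0 : ℝ) ≤ (riemannZetaZeroOrder (ρ : ℂ) : ℝ) := fun ρ ↦ by
    exact_mod_cast riemannZetaZeroOrder_nonneg
      (ZetaZeros.riemannZetaNontrivialZeros.ne_one ρ.2)
  -- termwise convergence `ĝ_k(s) → û(s)`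
  have hGU : ∀ s : ℂ, Tendsto (fun k ↦ weilMellin (g k) s) atTop (𝓝 (weilMellin u s)) :=
    fun s ↦ ConnesVanSuijlekom.tendsto_weilMellin hu (fun m ↦ ⟨(hg m).1, (hg m).2.1⟩) hL s
  -- form-boundedness on the differences `gₙ - g_k`
  have hWs : ∀ n k (s : ℂ),
      weilMellin (g n - g k) s = weilMellin (g n) s - weilMellin (g k) s := fun n k s ↦
    weilMellin_sub (hg n).1.1.continuous (hg n).1.2 (hg k).1.1.continuous (hg k).1.2 s
  have hHF : ∀ n k, Summable (fun ρ : ZetaZeros.riemannZetaNontrivialZeros ↦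
      (riemannZetaZeroOrder (ρ : ℂ) : ℝ) * ‖weilMellin (g n) ρ - weilMellin (g k) ρ‖ ^ 2) ∧
      ∑' ρ : ZetaZeros.riemannZetaNontrivialZeros,
        (riemannZetaZeroOrder (ρ : ℂ) : ℝ) * ‖weilMellin (g n) ρ - weilMellin (g k) ρ‖ ^ 2 ≤
      A * (weilQuadratic (g n - g k)).re + B * ∫ t, ‖g n t - g k t‖ ^ 2 := by
    intro n k
    have h := hAB (g n - g k) ((hg n).1.sub (hg k).1)
      (energyCauchy_tsupport_sub_subset (hg n).2.1 (hg k).2.1)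
    simp only [hWs, Pi.sub_apply] at h
    exact h
  -- the Cauchy modulus tends to `0` on `ℕ × ℕ`
  have hδ : Tendsto (fun p : ℕ × ℕ ↦ A * (weilQuadratic (g p.1 - g p.2)).re +
      B * ∫ t, ‖g p.1 t - g p.2 t‖ ^ 2) atTop (𝓝 0) := by
    have h1 := stub_energyCauchy a u g hu.memLp hg hQ hL
    have h2 := samplingCauchy_tendsto_integral_norm_sq_sub hu.memLp hgm hL
    simpa using (h1.const_mul A).add (h2.const_mul B)
  -- key: for `n ≥ N(ε)` the family `m‖ĝₙ - û‖²` is summable with sum `≤ ε`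
  have key : ∀ ε : ℝ, 0 < ε → ∃ N : ℕ, ∀ n, N ≤ n →
      Summable (fun ρ : ZetaZeros.riemannZetaNontrivialZeros ↦
        (riemannZetaZeroOrder (ρ : ℂ) : ℝ) * ‖weilMellin (g n) ρ - weilMellin u ρ‖ ^ 2) ∧
      ∑' ρ : ZetaZeros.riemannZetaNontrivialZeros,
        (riemannZetaZeroOrder (ρ : ℂ) : ℝ) * ‖weilMellin (g n) ρ - weilMellin u ρ‖ ^ 2 ≤ ε := by
    intro ε hε
    obtain ⟨N, hN⟩ := eventually_atTop_prod_self'.1 (hδ.eventually (eventually_lt_nhds hε))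
    refine ⟨N, fun n hn ↦ ?_⟩
    have h0 : ∀ ρ : ZetaZeros.riemannZetaNontrivialZeros,
        0 ≤ (riemannZetaZeroOrder (ρ : ℂ) : ℝ) * ‖weilMellin (g n) ρ - weilMellin u ρ‖ ^ 2 :=
      fun ρ ↦ mul_nonneg (hm0 ρ) (by positivity)
    -- every finite partial sum is `≤ ε` (Fatou on finite sums)
    have hfin : ∀ T : Finset ZetaZeros.riemannZetaNontrivialZeros,
        ∑ ρ ∈ T, (riemannZetaZeroOrder (ρ : ℂ) : ℝ) *
          ‖weilMellin (g n) ρ - weilMellin u ρ‖ ^ 2 ≤ ε := by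
      intro T
      have hT : Tendsto (fun k ↦ ∑ ρ ∈ T, (riemannZetaZeroOrder (ρ : ℂ) : ℝ) *
          ‖weilMellin (g n) ρ - weilMellin (g k) ρ‖ ^ 2) atTop
          (𝓝 (∑ ρ ∈ T, (riemannZetaZeroOrder (ρ : ℂ) : ℝ) *
            ‖weilMellin (g n) ρ - weilMellin u ρ‖ ^ 2)) :=
        tendsto_finsetSum T fun ρ _ ↦
          ((tendsto_const_nhds.sub (hGU ρ)).norm.pow 2).const_mul _
      refine le_of_tendsto hT ?_
      filter_upwards [eventually_ge_atTop N] with k hk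
      calc ∑ ρ ∈ T, (riemannZetaZeroOrder (ρ : ℂ) : ℝ) *
              ‖weilMellin (g n) ρ - weilMellin (g k) ρ‖ ^ 2
          ≤ ∑' ρ : ZetaZeros.riemannZetaNontrivialZeros, (riemannZetaZeroOrder (ρ : ℂ) : ℝ) *
              ‖weilMellin (g n) ρ - weilMellin (g k) ρ‖ ^ 2 :=
            (hHF n k).1.sum_le_tsum T fun ρ _ ↦ mul_nonneg (hm0 ρ) (by positivity)
        _ ≤ A * (weilQuadratic (g n - g k)).re + B * ∫ t, ‖g n t - g k t‖ ^ 2 := (hHF n k).2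
        _ ≤ ε := (hN n hn k hk).le
    exact ⟨summable_of_sum_le h0 hfin, Real.tsum_le_of_sum_le h0 hfin⟩
  refine ⟨?_, fun n ↦ ?_, ?_⟩
  · -- `Σ m‖û‖² < ∞`: `‖û‖² ≤ 2‖ĝ_N‖² + 2‖ĝ_N - û‖²`
    obtain ⟨N, hN⟩ := key 1 one_pos
    have h1 := (hAB (g N) (hg N).1 (hg N).2.1).1
    have h2 := (hN N le_rfl).1
    refine Summable.of_nonneg_of_le (fun ρ ↦ mul_nonneg (hm0 ρ) (by positivity))
      (fun ρ ↦ ?_) ((h1.mul_left 2).add (h2.mul_left 2))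
    have h := samplingCauchy_mul_norm_sub_sq_le (hm0 ρ) 0 (weilMellin (g N) ρ) (weilMellin u ρ)
    simpa only [zero_sub, norm_neg] using h
  · -- each `Σ m‖ĝₙ - û‖² < ∞`: through `g_M`, `M = max n N`
    obtain ⟨N, hN⟩ := key 1 one_pos
    have h1 := (hHF n (max n N)).1
    have h2 := (hN (max n N) (le_max_right _ _)).1
    exact Summable.of_nonneg_of_le (fun ρ ↦ mul_nonneg (hm0 ρ) (by positivity))
      (fun ρ ↦ samplingCauchy_mul_norm_sub_sq_le (hm0 ρ) _ _ _)
      ((h1.mul_left 2).add (h2.mul_left 2))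
  · -- `Σ m‖ĝₙ - û‖² → 0`
    refine Metric.tendsto_atTop.2 fun ε hε ↦ ?_
    obtain ⟨N, hN⟩ := key (ε / 2) (half_pos hε)
    refine ⟨N, fun n hn ↦ ?_⟩
    rw [Real.dist_0_eq_abs, abs_of_nonneg (tsum_nonneg fun ρ ↦ mul_nonneg (hm0 ρ) (by positivity))]
    linarith [(hN n hn).2]

end Summit.RiemannHypothesis.RiemannHypothesis.Theorems.GroundStatesConvergeToXi

end
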